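import Mathlib
import Literature.Barriers.Parity.UniformBatemanHornBarrierProofs

/-!
# Crux triage (stmt-Parity-11292, round 1, triager 1): the first lemma `TiltedLargestPrime` of card
`tilt-flow-one-prime-marginals` is FALSE AS TYPED (indicator `∃ p > x` instead of the count `#{p > x}`).

Witness: the cubic Bateman–Horn system `f = X³ + 2` at the anchor `y = 1`. The typed sequence is a ratio of a
sub-sum by the full sum of non-negative terms, hence `≤ 1` for every `x`, while the typed limit is
`∫_{1/3}^{1} v⁻¹ dv = log 3 > 1`. (For `deg f ≥ 3` the PD(y) one-point intensity `β_g(y)` — the limit of the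
COUNT version `E_y[#{p > x : p ∣ f(n)}]`, which is what the card's informal (B) states — exceeds the tilted
PROBABILITY of `{∃ p > x}`; for `deg f = 2` the two coincide and nothing is claimed against the card there.)
Repair: weight `n` by `#{p > x prime : p ∣ f(n)}` in the numerator, or restrict to `natDegree f ≤ 2`.
-/

open Filter Polynomial MeasureTheory
open scoped Topology Classical

noncomputable section

namespace Summit.Parity.BatemanHorn.Cruxes.SystemLSDRealSegment.Triage

/-! ## Verbatim copies of the typed objects (tree file
`Summits/Parity/BatemanHorn/Cruxes/SystemLSDRealSegment/Ideator3Sketch.lean`, namespace `…Ideator3Sketch`;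
that crux workfile is not a built module on the farm, so it cannot be imported here). -/

/-- COPY of `Ideator3Sketch.cappedOmega`. -/
noncomputable def cappedOmega (m : ℕ) : ℕ := m.factorization.sum fun _ v => min v 2

/-- COPY of `Ideator3Sketch.TiltedLargestPrime` (card tilt-flow-one-prime-marginals, First lemma). -/
noncomputable def TiltedLargestPrime : Prop :=
  ∀ f : Polynomial ℤ, Literature.NumberTheory.Sieve.IsBatemanHornSystem ![f] →
    ∀ y : ℝ, 1 ≤ y → y < 7 / 4 →
      Tendsto (fun x : ℕ =>
          (∑ n ∈ (Finset.range (x + 1)).filter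
              (fun n : ℕ => ∃ p : ℕ, p.Prime ∧ x < p ∧ (p : ℤ) ∣ f.eval (n : ℤ)),
            y ^ cappedOmega (f.eval (n : ℤ)).toNat) /
          (∑ n ∈ Finset.range (x + 1), y ^ cappedOmega (f.eval (n : ℤ)).toNat))
        atTop (nhds (∫ v in Set.Ioo (1 / (f.natDegree : ℝ)) 1, y * v⁻¹ * (1 - v) ^ (y - 1)))

/-- `∫_{1/3}^{1} v⁻¹ dv = log 3` as a set integral over `Ioo`. [folklore] -/
theorem integral_inv_Ioo_third : ∫ v in Set.Ioo (1 / (3 : ℝ)) 1, v⁻¹ = Real.log 3 := by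
  rw [← integral_Ioc_eq_integral_Ioo, ← intervalIntegral.integral_of_le (by norm_num),
    integral_inv_of_pos (by norm_num) (by norm_num)]
  norm_num

/-- `1 < log 3`. [folklore] -/
theorem one_lt_log_three : (1 : ℝ) < Real.log 3 := by
  rw [Real.lt_log_iff_exp_lt (by norm_num)]
  have := Real.exp_one_lt_d9
  linarith

/-- The typed first lemma `TiltedLargestPrime` (card tilt-flow-one-prime-marginals, Ideator3Sketch) is false:
witness `f = X³ + 2`, `y = 1` (ratio `≤ 1`, claimed limit `log 3 > 1`). [folklore] -/
theorem not_tiltedLargestPrime : ¬ TiltedLargestPrime := by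
  intro h
  have hf : Literature.NumberTheory.Sieve.IsBatemanHornSystem ![(X ^ 3 + C ((2 : ℕ) : ℤ) : ℤ[X])] :=
    Literature.Barriers.Parity.UniformBatemanHornMatrix.isBatemanHornSystem_X_pow_add_C (d := 3) (c := 2) (q := 2)
      (by norm_num) Nat.prime_two (dvd_refl 2) (by decide)
  have hlim := h (X ^ 3 + C ((2 : ℕ) : ℤ)) hf 1 le_rfl (by norm_num)
  have hdeg : (X ^ 3 + C ((2 : ℕ) : ℤ) : ℤ[X]).natDegree = 3 := natDegree_X_pow_add_C
  rw [hdeg] at hlim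
  have htarget : (∫ v in Set.Ioo (1 / ((3 : ℕ) : ℝ)) 1, (1 : ℝ) * v⁻¹ * (1 - v) ^ ((1 : ℝ) - 1)) = Real.log 3 := by
    have : (fun v : ℝ => (1 : ℝ) * v⁻¹ * (1 - v) ^ ((1 : ℝ) - 1)) = fun v => v⁻¹ := by
      funext v; simp
    rw [this]
    exact_mod_cast integral_inv_Ioo_third
  rw [htarget] at hlim
  -- every term of the sequence is ≤ 1
  have hle : ∀ x : ℕ,
      (∑ n ∈ (Finset.range (x + 1)).filter
          (fun n : ℕ => ∃ p : ℕ, p.Prime ∧ x < p ∧ (p : ℤ) ∣ (X ^ 3 + C ((2 : ℕ) : ℤ) : ℤ[X]).eval (n : ℤ)),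
          (1 : ℝ) ^ cappedOmega ((X ^ 3 + C ((2 : ℕ) : ℤ) : ℤ[X]).eval (n : ℤ)).toNat) /
        (∑ n ∈ Finset.range (x + 1), (1 : ℝ) ^ cappedOmega ((X ^ 3 + C ((2 : ℕ) : ℤ) : ℤ[X]).eval (n : ℤ)).toNat)
        ≤ 1 := by
    intro x
    refine div_le_one_of_le₀ ?_ (Finset.sum_nonneg fun _ _ => by positivity)
    exact Finset.sum_le_sum_of_subset_of_nonneg (Finset.filter_subset _ _) fun _ _ _ => by positivity
  have := le_of_tendsto' hlim hle
  linarith [one_lt_log_three]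

end Summit.Parity.BatemanHorn.Cruxes.SystemLSDRealSegment.Triage

end
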